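import Mathlib.Analysis.Normed.Module.Connected
import Mathlib.Analysis.Complex.Basic
import Mathlib.LinearAlgebra.Complex.FiniteDimensional
import Mathlib.Analysis.SpecialFunctions.Complex.Log

/-!
# The exterior of a disc in `ℂ` is preconnected

Crux `WitnessCharge` (item stmt-SmoothPoincare4-7824, route route-SmoothPoincare4-SullivanDual),
line `Sketch`, stub `helper_isPreconnected_normGt`.

The degree argument for the flat coordinate of a pencil member (a proper holomorphic map onto
the exterior `A_R = {z | R < ‖z‖}` of a disc) needs `A_R` connected. Mathlib has connectedness
of spheres and of complements of countable sets, but not of complements of balls; we supply it.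

Proof: for `R < 0` the set is all of `ℂ`. For `0 ≤ R` it is the image under the continuous map
`Complex.exp` of `{w | R < Real.exp w.re}` (`‖exp w‖ = exp (re w)`, and every `z` with
`R < ‖z‖` is nonzero, hence `z = exp (log z)`); the latter set is the preimage under the
`ℝ`-linear map `re` of the order-connected, hence convex, set `Real.exp ⁻¹' (R, ∞) ⊆ ℝ`, so it is
convex and therefore preconnected.
-/

noncomputable section

set_option linter.dupNamespace false

open Set Filter Topology Metric

namespace Summit.SmoothPoincare4.SmoothPoincare4.Theorems.WitnessCharge.PencilIncompleteness

/-- **The exterior of a disc in `ℂ` is preconnected.** For every real `R`, the set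
`{z : ℂ | R < ‖z‖}` is preconnected: for `R < 0` it is `univ`; for `0 ≤ R` it is the image under
`Complex.exp` of the convex set `{w : ℂ | R < Real.exp w.re}`. -/
theorem helper_isPreconnected_normGt :
    ∀ R : ℝ, IsPreconnected {z : ℂ | R < ‖z‖} := by
  intro R
  rcases lt_or_ge R 0 with hR | hR
  · -- the set is everything
    have huniv : {z : ℂ | R < ‖z‖} = univ :=
      eq_univ_of_forall fun z => hR.trans_le (norm_nonneg z)
    rw [huniv]
    exact isPreconnected_univ
  · -- the set is `exp '' {w | R < Real.exp w.re}`, the image of a convex set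
    have hconv : Convex ℝ {w : ℂ | R < Real.exp w.re} := by
      have hpre : {w : ℂ | R < Real.exp w.re} = Complex.reLm ⁻¹' (Real.exp ⁻¹' Ioi R) := rfl
      rw [hpre]
      exact ((ordConnected_Ioi.preimage_mono Real.exp_monotone).convex).linear_preimage _
    have heq : {z : ℂ | R < ‖z‖} = Complex.exp '' {w : ℂ | R < Real.exp w.re} := by
      ext z
      constructor
      · intro hz
        have hz0 : z ≠ 0 := norm_pos_iff.1 (hR.trans_lt hz)
        refine ⟨Complex.log z, ?_, Complex.exp_log hz0⟩
        simp only [mem_setOf_eq, Complex.log_re]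
        rwa [Real.exp_log (norm_pos_iff.2 hz0)]
      · rintro ⟨w, hw, rfl⟩
        simpa only [mem_setOf_eq, Complex.norm_exp] using hw
    rw [heq]
    exact hconv.isPreconnected.image _ Complex.continuous_exp.continuousOn

end Summit.SmoothPoincare4.SmoothPoincare4.Theorems.WitnessCharge.PencilIncompleteness
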